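import Summits.QuantumFields.YangMills.Theorems.UnitScaleTiltProp7SymFrameCovDefs
import Summits.QuantumFields.YangMills.Theorems.UnitScaleTiltProp8ChartLocalityFlat
import HarnessLib

/-!
# Route `UnitScaleTilt`, crux «MinimiserStabilityRegPr» (stmt-QuantumFields-19200, stub EX `stub_existenceMinimalOrbit`), route (α) —
# **THE COVARIANT DOUBLE-BAR TOWER AND ITS ACCUMULATED SYMMETRIC FRAMES ARE BLOCK-LOCAL** (the `U₀ ≠ 1` twins of ✓`Prop8ChartLocalityFlat` §1–§2 for the letters of
# ✓`Prop7SymFrameCovDefs`: `tstairU`, `vframeCovU`, `dbarCovU`, `dbarCovIterU`, `frameAccU` — piece (P1) of LOCATE «W6» px18 g2, the read set behind the coarse column of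
# `fderiv CmapTwS`)

Cell `ym3-torus` (HUMAN RULING D-0037, YM ladder rung R3 — YM₃ on T³ is a rung, NOT d = 4, NOT a mass gap, NOT Clay), width seat `ym3-torus-px18` (gen 2).
THEOREMS ONLY (0 `def`, 0 `sorry`); `--supports stmt-QuantumFields-19200 --as helper`; count-neutral.  Generic `P : Params`, any complete normed ℂ-algebra `𝔸`;
nothing of [Balaban1985Averaging] is asserted (which bond variables a finite product∕mean reads).

THE PRINT.  [Balaban1985Averaging] (58) p. 27 (the twisted stair transporters `R_{0,y}W₁`), (82) p. 30 (the frame `\overline{R_{0,y}W₁}`), (89)–(92) p. 31 (the double bar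
`(U̿₁U₀)_c = (\overline{R_{0,c₋}U₁})⁻¹ Ũ₁ R̄_{0,c} \overline{R_{0,c₊}U₁}`), (97) p. 32 (accumulated frames), (110) p. 34 («the averages depend on the variables in the
blocks only»), (127) p. 36 ∕ (150) p. 40 (iteration against the background tower); [Balaban1987RG1] (0.3)–(0.4) pp. 252–253 (centre staircases inside the block).

WHAT IS PROVED (sorry-free, no definition; the background `U₀` is FIXED throughout — only the full field `W` varies, which is how `A ↦ e^{A}·U₀♭` enters the chart of record).
* §1 one level `j → j+1`: `tstairU_congr` ∕ ★`vframeCovU_congr` — the twisted transporters and the covariant frame at `y` read only the bonds of `W` with BOTH end-points in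
  `B(y)` (the stair words are ✓`Prop8ChartDoubleBar.vframeU`'s: ✓`ChartHInv.blockOf_of_mem_walk_stairWord` + ✓`Prop8Chart.holT_congr`); ★`dbarCovU_congr₂` — the covariant
  double bar at `c` reads only the bonds with both end-points in `B(c₋) ∪ B(c₊)` (✓`Prop8Chart.emlAvgU_congr₂` + the two frames; the proof of ✓`dbarAvgU_congr₂` verbatim).
* §2 the tower: ★★`dbarCovIterU_congr_of_agree` — `(U̿₁·Ū₀)^{(j)}(c)` reads only the FINE bonds `b` with `Bʲ(b₋), Bʲ(b₊) ∈ {c₋, c₊}` (induction; the tower backgrounds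
  `emlIterU k U₀` do not depend on `W`), ★★`frameAccU_congr_of_agree` — the accumulated frame `v_k(y)` reads only the fine bonds `b` with `Bᵏ(b₋) = Bᵏ(b₊) = y`
  (induction on (97) `v_{k+1}(y) = v_k(emb y)·w_k(y)`: `Bᵏ(emb y)`-reads sit under `B^{k+1}(y)` by ✓`TorusGeometry` `Site.blockOf_emb`, and the one-level frame reads level-`k`
  bonds inside `B(y)`, each reading fine bonds under its two `k`-blocks ⊆ `B^{k+1}(y)`); `_add_of_vanish` forms of both.
HONEST SCOPE.  Read-set bookkeeping only; the T³ read set of `dbarTwS`∕`CmapTwS` (piece (P2)) and the column (P3) are separate files.  Nothing here claims EX, the crux,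
d = 4 or the mass gap.

References: T. Bałaban, CMP **98** (1985) 17–51 [Balaban1985Averaging] ((58) p.27, (82) p.30, (89)–(92) p.31, (97) p.32, (110) p.34, (127) p.36, (150) p.40); CMP **109**
(1987) 249–301 [Balaban1987RG1] ((0.3)–(0.4) pp.252–253); CMP **95** (1984) 17–40 [Balaban1984PropagatorsI] ((1.18) p.20).
-/

set_option autoImplicit false

noncomputable section

namespace Summit.QuantumFields.YangMills.Theorems.Prop7SymFrameCovLocality

open Literature.MathematicalPhysics.QuantumFieldTheory.Balaban1983to89
open T4Continuum BlockAveraging ExpMeanLog MatrixLog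
open B10Eq27TorusAxialLog (holT)
open B5Eq118OneStroke (iterBlockOf iterBlockOf_succ iterBlockOf_zero)
open Summit.QuantumFields.YangMills.Theorems.Prop8Chart (emlAvgU emlIterU holT_congr emlAvgU_congr₂)
open Summit.QuantumFields.YangMills.Theorems.ChartHInv (blockOf_of_mem_walk_stairWord)
open Summit.QuantumFields.YangMills.Theorems.Prop7SymAvgTwSym (tstairU tstairU_def vframeCovU coe_vframeCovU dbarCovU dbarCovU_apply dbarCovIterU dbarCovIterU_zero
  dbarCovIterU_succ frameAccU frameAccU_zero frameAccU_succ)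

variable {P : Params} {𝔸 : Type*} [NormedRing 𝔸] [NormedAlgebra ℂ 𝔸] [CompleteSpace 𝔸]

/-! ## §1 One level: the twisted transporters, the covariant frame and the covariant double bar are block-local -/

section OneLevel

variable {j : ℕ}

omit [NormedAlgebra ℂ 𝔸] [CompleteSpace 𝔸] in
/-- **THE TWISTED STAIR TRANSPORTER `(R_{0,y}W₁)(Γ_{y,i}) = W(Γ)·U₀(Γ)⁻¹` READS ONLY THE BONDS OF `W` INSIDE `B(y)`** (the centre staircase of index `i` stays in its block).
[cite: Balaban1985Averaging, (58) p.27; Balaban1987RG1, (0.3) p.252] -/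
theorem tstairU_congr (hj : j + 1 ≤ P.m + P.K) (U₀ : GaugeField P j 𝔸ˣ) {W W' : GaugeField P j 𝔸ˣ} (y : Site P (j + 1))
    (hWW' : ∀ b : PBond P j, blockOf b.src = y → blockOf b.tgt = y → W b = W' b) (i : Idx P) :
    tstairU U₀ W y i = tstairU U₀ W' y i := by
  rw [tstairU_def, tstairU_def, holT_congr (stairWord i.2.1 (off i.1)) (emb y) fun s hs =>
    hWW' s.bond (blockOf_of_mem_walk_stairWord hj y i.2.1 i.1 hs).1 (blockOf_of_mem_walk_stairWord hj y i.2.1 i.1 hs).2]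

/-- ★ **THE SYMMETRIC COVARIANT FRAME `w_sym(y)` READS ONLY THE BONDS OF `W` INSIDE `B(y)`** (the `U₀ ≠ 1` twin of ✓`Prop8ChartDoubleBar.vframeU_congr`).
[cite: Balaban1985Averaging, (82) p.30, (110) p.34; Balaban1987RG1, (0.3) p.252] -/
theorem vframeCovU_congr (hj : j + 1 ≤ P.m + P.K) (U₀ : GaugeField P j 𝔸ˣ) {W W' : GaugeField P j 𝔸ˣ} (y : Site P (j + 1))
    (hWW' : ∀ b : PBond P j, blockOf b.src = y → blockOf b.tgt = y → W b = W' b) : vframeCovU U₀ W y = vframeCovU U₀ W' y := by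
  apply Units.ext
  rw [coe_vframeCovU, coe_vframeCovU]
  have h : (fun i : Idx P => ((tstairU U₀ W y i : 𝔸ˣ) : 𝔸)) = fun i : Idx P => ((tstairU U₀ W' y i : 𝔸ˣ) : 𝔸) := by
    funext i
    rw [tstairU_congr hj U₀ y hWW' i]
  rw [h]

/-- ★ **THE COVARIANT DOUBLE BAR IS TWO-BLOCK LOCAL**: `(U̿₁·Ū₀)(c) = w(c₋)⁻¹·W̄(c)·w(c₊)` depends only on the bonds of `W` with both end-points in `B(c₋) ∪ B(c₊)` (the
`U₀ ≠ 1` twin of ✓`dbarAvgU_congr₂`). [cite: Balaban1985Averaging, (89) p.31, (110) p.34; Balaban1987RG1, (0.4) p.253] -/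
theorem dbarCovU_congr₂ (hj : j + 1 ≤ P.m + P.K) (U₀ : GaugeField P j 𝔸ˣ) {W W' : GaugeField P j 𝔸ˣ} (c : PBond P (j + 1))
    (hWW' : ∀ b : PBond P j, (blockOf b.src = c.src ∨ blockOf b.src = c.tgt) → (blockOf b.tgt = c.src ∨ blockOf b.tgt = c.tgt) → W b = W' b) :
    dbarCovU U₀ W c = dbarCovU U₀ W' c := by
  rw [dbarCovU_apply, dbarCovU_apply, emlAvgU_congr₂ hj c hWW',
    vframeCovU_congr hj U₀ c.src (fun b h1 h2 => hWW' b (Or.inl h1) (Or.inl h2)),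
    vframeCovU_congr hj U₀ c.tgt (fun b h1 h2 => hWW' b (Or.inr h1) (Or.inr h2))]

end OneLevel

/-! ## §2 The tower: the covariant double-bar tower and the accumulated frames read the fine bonds under their blocks -/

section Tower

/-- ★★ **THE `j`-FOLD COVARIANT DOUBLE-BAR AVERAGE AT `c` READS ONLY THE FINE BONDS UNDER THE TWO `j`-BLOCKS OF `c`** (`Bʲ(b₋), Bʲ(b₊) ∈ {c₋, c₊}`; induction over the
levels with §1 — the frames are recomputed against the `W`-independent backgrounds `Ū₀ᵏ = emlIterU k U₀`).  The `U₀ ≠ 1` twin of ✓`dbarIterU_congr_of_agree`.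
[cite: Balaban1985Averaging, (127) p.36, (150) p.40; Balaban1987RG1, (0.4) p.253] -/
theorem dbarCovIterU_congr_of_agree (U₀ : GaugeField P 0 𝔸ˣ) :
    ∀ (j : ℕ), j ≤ P.m + P.K → ∀ {W W' : GaugeField P 0 𝔸ˣ} (c : PBond P j),
      (∀ b : PBond P 0, (iterBlockOf j b.src = c.src ∨ iterBlockOf j b.src = c.tgt) →
        (iterBlockOf j b.tgt = c.src ∨ iterBlockOf j b.tgt = c.tgt) → W b = W' b) →
      dbarCovIterU j U₀ W c = dbarCovIterU j U₀ W' c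
  | 0, _, W, W', c, h => by
    rw [dbarCovIterU_zero, dbarCovIterU_zero]
    exact h c (Or.inl rfl) (Or.inr rfl)
  | j + 1, hj, W, W', c, h => by
    rw [dbarCovIterU_succ, dbarCovIterU_succ]
    refine dbarCovU_congr₂ hj (emlIterU j U₀) c fun e hes het =>
      dbarCovIterU_congr_of_agree U₀ j (Nat.le_of_succ_le hj) e fun b hbs hbt => h b ?_ ?_
    · rw [iterBlockOf_succ]
      rcases hbs with h1 | h1 <;> rw [h1]
      · exact hes
      · exact het
    · rw [iterBlockOf_succ]
      rcases hbt with h1 | h1 <;> rw [h1]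
      · exact hes
      · exact het

/-- ★★ **THE ACCUMULATED SYMMETRIC FRAME `v_k(y)` READS ONLY THE FINE BONDS UNDER THE `k`-BLOCK OF `y`** (`Bᵏ(b₋) = Bᵏ(b₊) = y`): by (97) `v_{k+1}(y) = v_k(emb y)·w_k(y)`,
the first factor reads `Bᵏ(emb y) ⊂ B^{k+1}(y)` (✓`TorusGeometry` `Site.blockOf_emb`), the second the level-`k` bonds inside `B(y)` through the tower, i.e. fine bonds under `B^{k+1}(y)`.
[cite: Balaban1985Averaging, (97) p.32, (110) p.34, (127) p.36] -/
theorem frameAccU_congr_of_agree (U₀ : GaugeField P 0 𝔸ˣ) :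
    ∀ (k : ℕ), k ≤ P.m + P.K → ∀ {W W' : GaugeField P 0 𝔸ˣ} (y : Site P k),
      (∀ b : PBond P 0, iterBlockOf k b.src = y → iterBlockOf k b.tgt = y → W b = W' b) →
      frameAccU k U₀ W y = frameAccU k U₀ W' y
  | 0, _, W, W', y, _ => by rw [frameAccU_zero, frameAccU_zero]
  | k + 1, hk, W, W', y, h => by
    rw [frameAccU_succ, frameAccU_succ,
      frameAccU_congr_of_agree U₀ k (Nat.le_of_succ_le hk) (emb y) (W := W) (W' := W') fun b hbs hbt => h b
        (by rw [iterBlockOf_succ, hbs, Site.blockOf_emb hk]) (by rw [iterBlockOf_succ, hbt, Site.blockOf_emb hk]),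
      vframeCovU_congr hk (emlIterU k U₀) y fun e he1 he2 =>
        dbarCovIterU_congr_of_agree U₀ k (Nat.le_of_succ_le hk) e fun b hbs hbt => h b ?_ ?_]
    · rw [iterBlockOf_succ]
      rcases hbs with h1 | h1 <;> rw [h1]
      · exact he1
      · exact he2
    · rw [iterBlockOf_succ]
      rcases hbt with h1 | h1 <;> rw [h1]
      · exact he1
      · exact he2

/-- **EQUIVALENTLY: CHANGING `W` ON FINE BONDS NOT UNDER THE TWO `j`-BLOCKS OF `c` DOES NOT CHANGE `(U̿₁·Ū₀)^{(j)}(c)`** (multiplicative form `W·V` with `V = 1` on the read set).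
[cite: Balaban1985Averaging, (127) p.36; Balaban1987RG1, (0.4) p.253] -/
theorem dbarCovIterU_mul_of_one_on_read (U₀ : GaugeField P 0 𝔸ˣ) {j : ℕ} (hj : j ≤ P.m + P.K) (W V : GaugeField P 0 𝔸ˣ) (c : PBond P j)
    (hV : ∀ b : PBond P 0, (iterBlockOf j b.src = c.src ∨ iterBlockOf j b.src = c.tgt) →
      (iterBlockOf j b.tgt = c.src ∨ iterBlockOf j b.tgt = c.tgt) → V b = 1) :
    dbarCovIterU j U₀ (fun b => V b * W b) c = dbarCovIterU j U₀ W c :=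
  dbarCovIterU_congr_of_agree U₀ j hj c fun b hbs hbt => by rw [hV b hbs hbt, one_mul]

/-- … and the same for the accumulated frame `v_k(y)`. [cite: Balaban1985Averaging, (97) p.32, (127) p.36] -/
theorem frameAccU_mul_of_one_on_read (U₀ : GaugeField P 0 𝔸ˣ) {k : ℕ} (hk : k ≤ P.m + P.K) (W V : GaugeField P 0 𝔸ˣ) (y : Site P k)
    (hV : ∀ b : PBond P 0, iterBlockOf k b.src = y → iterBlockOf k b.tgt = y → V b = 1) :
    frameAccU k U₀ (fun b => V b * W b) y = frameAccU k U₀ W y :=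
  frameAccU_congr_of_agree U₀ k hk y fun b hbs hbt => by rw [hV b hbs hbt, one_mul]

end Tower

end Summit.QuantumFields.YangMills.Theorems.Prop7SymFrameCovLocality

end
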